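import Literature.AlgebraicGeometry.AbelianSchemes.AbelianSchemeOverBase
import Literature.AlgebraicGeometry.RelativeSpec.FiniteGroupQuotient
import Mathlib.LinearAlgebra.Matrix.GeneralLinearGroup.Defs
import Mathlib.LinearAlgebra.Matrix.NonsingularInverse
import HarnessLib

/-!
# The re-basing action of `GL(J, ℤ/M)` on the fibre power `A[M]^J` of the `M`-torsion of an abelian scheme

Layer `Literature/AlgebraicGeometry/AbelianSchemes`, namespace `Literature.AlgebraicGeometry.AbelianSchemes.AbelianSchemeOver`.
THEOREMS ONLY (no `def`, no instance, no notation, no `sorry`): the action is produced inside an `∃` in the tree's carrier ★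
`RelativeSpec.ActionOver`.  Cell `hodgecm-mathlib` (D-0151), F-3 (M) carrier package (Ma0) FILE B1 (B-plan1 (g19) M-cut v0.1 «CARRIER
DECISION»: `G := GL_{2g}(ℤ/m)` acting on the level-`m`-basis cover BY RE-BASING).  HC_CM is proved only modulo the 7 printed citations
until rung 0 closes; nothing here is about HC.

## Source
[MumfordFogartyKirwan1994] Ch. 7 §2, proof of Prop. 7.3, step (IV) (pp. 133–134) and §3 Lemma 7.11 (p. 140): the group `GL(2g, ℤ/n)`
acts on the set of level-`n` structures `(σ₁, …, σ_{2g}) ↦ (Σⱼ γ₁ⱼσⱼ, …, Σⱼ γ₀_{2g,j}σⱼ)`, hence on the scheme of `2g`-tuples of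
`n`-torsion points; [GortzWedhorn2023] Prop. 27.188 (1) (`X[n]` étale-locally `(ℤ/nℤ)^{2g}`).

## What is proved
For an abelian scheme `A/S` with commutative group law and data
* `(AM, incl, hpow, hlift, hinj)` — an `S`-scheme `A_M → A` through which exactly the `M`-torsion `Y`-points of `A` factor, uniquely
  (the ∃-output of ★ `AbelianSchemeOver.exists_torsion_subscheme`), and
* `(T, π, hTex, hTuniq)` — a fibre power `T = A_M^{×_S J}` with projections `πᵢ` (the ∃-output of ★ `Morphisms.exists_power_finite_etale`),
we prove:
* `prod_pow_val_pow_val_eq` — the EXPONENT ARITHMETIC: for `M`-torsion elements `x_k` of a commutative monoid,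
  `∏ᵢ (∏ⱼ xⱼ^{γ₀ᵢⱼ})^{aᵢ} = ∏ⱼ xⱼ^{(a ᵥ* γ₀)ⱼ}` (exponents read in `ℕ` through `ZMod.val`; they agree modulo `M`);
* `prod_pow_val_one_row` — `∏ⱼ xⱼ^{δᵢⱼ} = xᵢ`;
* **`exists_actionOver_rebase`** — there is `ρ : ActionOver T.hom (GL J (ℤ/M))` whose automorphism `ρ.aut γ₀` underlies an `S`-morphism
  `u_γ₀ : T → T` with `u_γ₀ ≫ πᵢ ≫ incl = ∏ⱼ (πⱼ ≫ incl)^{γ₀ᵢⱼ}` (ROWS of `γ₀`; with this convention `u_{γ₀′} ≫ u_γ₀ = u_{γ₀γ₀′}`, which is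
  Mathlib's multiplication on `Aut`);
* `comp_prod_pow_val_of_rebase` — consequently `u_γ₀ ≫ ∏ᵢ (πᵢ ≫ incl)^{aᵢ} = ∏ⱼ (πⱼ ≫ incl)^{(a ᵥ* γ₀)ⱼ}`: `u_γ₀` transports the
  combination with coefficient vector `a` to the one with `a ᵥ* γ₀` — the formula FILE B2 uses for stability of the basis locus,
  freeness and transitivity.

## References
* [MumfordFogartyKirwan1994] D. Mumford, J. Fogarty, F. Kirwan, *Geometric Invariant Theory*, 3rd ed. (1994), Ch. 7 §2 Prop. 7.3,
  proof, step (IV) (pp. 133–134); §3 Lemma 7.11 (p. 140).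
* [GortzWedhorn2023] U. Görtz, T. Wedhorn, *Algebraic Geometry II* (2023), Prop. 27.188 (1) (p. 675).
-/

noncomputable section

universe u

open CategoryTheory CategoryTheory.Limits AlgebraicGeometry MonoidalCategory CartesianMonoidalCategory Matrix

open scoped MonObj

namespace Literature.AlgebraicGeometry.AbelianSchemes

namespace AbelianSchemeOver

open Literature.AlgebraicGeometry.RelativeSpec

/-! ### §1 Exponent arithmetic for `M`-torsion elements of a commutative monoid -/

/-- **`∏ᵢ (∏ⱼ xⱼ^{γ₀ᵢⱼ})^{aᵢ} = ∏ⱼ xⱼ^{(a ᵥ* γ₀)ⱼ}`** for `M`-torsion `x_k` (`x_k^M = 1`) in a commutative monoid, a matrix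
`γ₀ ∈ M_ι(ℤ/M)` and a coefficient vector `a ∈ (ℤ/M)^J`, exponents read in `ℕ` through `ZMod.val` (the two exponents of `xⱼ`,
`Σᵢ γ₀ᵢⱼ aᵢ` computed in `ℕ` and `(Σᵢ aᵢγ₀ᵢⱼ).val`, agree modulo `M`).  Mumford's re-basing `(σᵢ) ↦ (Σⱼ γ₀ᵢⱼ σⱼ)` composed with
`a ↦ Σ aᵢ σᵢ`, multiplicatively. [cite: MumfordFogartyKirwan1994, Ch. 7 §2 Proposition 7.3, proof, step (IV) (pp. 133–134)] -/
theorem prod_pow_val_pow_val_eq {P : Type*} [CommMonoid P] {J : Type*} [Fintype J] {M : ℕ} [NeZero M]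
    (x : J → P) (hx : ∀ k, x k ^ M = 1) (γ₀ : Matrix J J (ZMod M)) (a : J → ZMod M) :
    ∏ i, (∏ j, x j ^ (γ₀ i j).val) ^ (a i).val = ∏ j, x j ^ ((a ᵥ* γ₀) j).val := by
  calc ∏ i, (∏ j, x j ^ (γ₀ i j).val) ^ (a i).val
      = ∏ i, ∏ j, x j ^ ((γ₀ i j).val * (a i).val) := by
        refine Finset.prod_congr rfl fun i _ => ?_
        rw [← Finset.prod_pow]
        exact Finset.prod_congr rfl fun j _ => (pow_mul _ _ _).symm
    _ = ∏ j, ∏ i, x j ^ ((γ₀ i j).val * (a i).val) := Finset.prod_comm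
    _ = ∏ j, x j ^ (∑ i, (γ₀ i j).val * (a i).val) :=
        Finset.prod_congr rfl fun j _ => Finset.prod_pow_eq_pow_sum _ _ _
    _ = ∏ j, x j ^ ((a ᵥ* γ₀) j).val := Finset.prod_congr rfl fun j _ => ?_
  -- the two exponents of `x j` agree modulo `M`
  rw [pow_eq_pow_mod _ (hx j), pow_eq_pow_mod ((a ᵥ* γ₀) j).val (hx j)]
  congr 1
  rw [← ZMod.natCast_eq_natCast_iff', ZMod.natCast_zmod_val]
  simp only [Matrix.vecMul, dotProduct, Nat.cast_sum, Nat.cast_mul, ZMod.natCast_zmod_val]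
  exact Finset.sum_congr rfl fun i _ => mul_comm _ _

/-- `x ^ (1 : ℤ/M).val = x` for `M`-torsion `x` (also when `M = 1`, where `x = 1`). [folklore] -/
private theorem pow_val_one_of_pow_eq_one {P : Type*} [Monoid P] {M : ℕ} (x : P) (hx : x ^ M = 1) :
    x ^ (1 : ZMod M).val = x := by
  rw [ZMod.val_one_eq_one_mod, ← pow_eq_pow_mod 1 hx, pow_one]

/-- **`∏ⱼ xⱼ^{δᵢⱼ} = xᵢ`**: the identity matrix re-bases trivially (`M`-torsion `x_k`).
[cite: MumfordFogartyKirwan1994, Ch. 7 §2 Proposition 7.3, proof, step (IV) (pp. 133–134)] -/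
theorem prod_pow_val_one_row {P : Type*} [CommMonoid P] {J : Type*} [Fintype J] [DecidableEq J] {M : ℕ}
    (x : J → P) (hx : ∀ k, x k ^ M = 1) (i : J) :
    ∏ j, x j ^ ((1 : Matrix J J (ZMod M)) i j).val = x i := by
  rw [Finset.prod_eq_single i (fun j _ hji => by rw [Matrix.one_apply_ne' hji, ZMod.val_zero, pow_zero])
    (fun h => (h (Finset.mem_univ i)).elim), Matrix.one_apply_eq]
  exact pow_val_one_of_pow_eq_one (x i) (hx i)

/-! ### §1b Linear algebra over `ℤ/M`: re-basing bijects, has trivial stabilisers on bases, and is transitive on bases -/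

/-- `a ↦ a ᵥ* γ₀` is injective for `γ₀ ∈ GL(J, ℤ/M)` (inverse `a ↦ a ᵥ* γ₀⁻¹`) — the linear algebra under the free
`GL_{2g}(ℤ/n)`-action on level-`n` structures, `(φ, α) ↦ (φ, α ∘ γ)`. [cite: MumfordFogartyKirwan1994, Ch. 7 §3 Lemma 7.11 (p. 140)] -/
theorem vecMul_coe_generalLinearGroup_injective {J : Type*} [Fintype J] [DecidableEq J] {R : Type*} [CommRing R]
    (γ₀ : Matrix.GeneralLinearGroup J R) : Function.Injective fun a : J → R => a ᵥ* (γ₀ : Matrix J J R) := by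
  intro a b hab
  have h := congrArg (fun c : J → R => c ᵥ* ((γ₀⁻¹ : Matrix.GeneralLinearGroup J R) : Matrix J J R)) hab
  simpa only [Matrix.vecMul_vecMul, ← Units.val_mul, mul_inv_cancel, Units.val_one, Matrix.vecMul_one] using h

/-- **Trivial stabiliser**: if `a ᵥ* γ₀ = a` for every coefficient vector `a` then `γ₀ = 1` (test on the standard basis:
`eᵢ ᵥ* γ₀` is the `i`-th row) — freeness of the re-basing action on bases. [cite: MumfordFogartyKirwan1994, Ch. 7 §3 Lemma 7.11 (p. 140)] -/
theorem generalLinearGroup_eq_one_of_forall_vecMul_eq {J : Type*} [Fintype J] [DecidableEq J] {R : Type*} [CommRing R]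
    (γ₀ : Matrix.GeneralLinearGroup J R) (h : ∀ a : J → R, a ᵥ* (γ₀ : Matrix J J R) = a) : γ₀ = 1 := by
  refine Units.ext (Matrix.ext fun i j => ?_)
  have hi := h (Pi.single i 1)
  rw [Matrix.single_one_vecMul] at hi
  rw [Units.val_one, Matrix.one_eq_pi_single]
  exact congrFun hi j

/-- For a homomorphism `φ : (ℤ/M)^J → P` (multiplicatively) and vectors `bᵢ ∈ (ℤ/M)^J`, the combination of the `φ(bᵢ)` with
coefficient vector `c` is `φ(c ᵥ* B)`, `B` the matrix with rows `bᵢ`: `∏ᵢ φ(bᵢ)^{cᵢ} = φ(Σᵢ cᵢ bᵢ)`.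
[cite: MumfordFogartyKirwan1994, Ch. 7 §2 Definition 7.1 (p. 129)] -/
theorem prod_map_ofAdd_pow_val_eq_map_vecMul {P : Type*} [CommMonoid P] {J : Type*} [Fintype J] {M : ℕ} [NeZero M]
    (φ : Multiplicative (J → ZMod M) →* P) (b : Matrix J J (ZMod M)) (c : J → ZMod M) :
    ∏ i, φ (Multiplicative.ofAdd (b i)) ^ (c i).val = φ (Multiplicative.ofAdd (c ᵥ* b)) := by
  rw [Matrix.vecMul_eq_sum, ofAdd_sum, map_prod]
  refine Finset.prod_congr rfl fun i _ => ?_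
  rw [← map_pow, ← ofAdd_nsmul, ← Nat.cast_smul_eq_nsmul (ZMod M), ZMod.natCast_zmod_val]

/-- **`GL(J, ℤ/M)` is transitive on ordered bases of a group `P[M] ≅ (ℤ/M)^J`** (the group theory behind «two level-`n`
structures of a geometric fibre differ by an element of `GL(2g, ℤ/n)`», [MumfordFogartyKirwan1994] Prop. 7.3 step (IV) / §3):
let `φ : (ℤ/M)^J ⥲ {y ∈ P | y^M = 1}` be an isomorphism onto the `M`-torsion (★ `exists_mulHom_torsion_fibrePoints` for a geometric
fibre of an abelian scheme) and `z₁, z₂ : J → P` two families of `M`-torsion elements whose combination maps `a ↦ ∏ᵢ z_k(i)^{aᵢ}`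
are injective; then `z₂(i) = ∏ⱼ z₁(j)^{γ₀ᵢⱼ}` for some `γ₀ ∈ GL(J, ℤ/M)`.  Proof: `z_k(i) = φ(b_k(i))`; the matrices `B_k` of rows
`b_k(i)` have injective, hence (finiteness) surjective `a ↦ a ᵥ* B_k`, so are units (Mathlib `Matrix.vecMul_surjective_iff_isUnit`);
`γ₀ := B₂B₁⁻¹`. [cite: MumfordFogartyKirwan1994, Ch. 7 §2 Proposition 7.3, proof, step (IV) (pp. 133–134)]
[cite: MumfordFogartyKirwan1994, Ch. 7 §3 Lemma 7.11 (p. 140)] -/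
theorem exists_generalLinearGroup_rebase_of_injective {P : Type*} [CommMonoid P] {J : Type*} [Fintype J] [DecidableEq J]
    {M : ℕ} [NeZero M] (φ : Multiplicative (J → ZMod M) →* P)
    (hrange : Set.range φ = {y | y ^ M = 1}) (z₁ z₂ : J → P) (hz₁ : ∀ i, z₁ i ^ M = 1) (hz₂ : ∀ i, z₂ i ^ M = 1)
    (h₁ : Function.Injective fun a : J → ZMod M => ∏ i, z₁ i ^ (a i).val)
    (h₂ : Function.Injective fun a : J → ZMod M => ∏ i, z₂ i ^ (a i).val) :
    ∃ γ₀ : Matrix.GeneralLinearGroup J (ZMod M), ∀ i, z₂ i = ∏ j, z₁ j ^ ((γ₀ : Matrix J J (ZMod M)) i j).val := by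
  classical
  -- coordinates: `z_k i = φ (B_k i)` for matrices `B_k` (rows = coordinate vectors)
  have hcoord : ∀ (z : J → P), (∀ i, z i ^ M = 1) →
      ∃ B : Matrix J J (ZMod M), ∀ i, φ (Multiplicative.ofAdd (B i)) = z i := by
    intro z hz
    have hmem : ∀ i, z i ∈ Set.range φ := fun i => by rw [hrange]; exact hz i
    choose b hb using hmem
    exact ⟨fun i j => Multiplicative.toAdd (b i) j, fun i => hb i⟩
  obtain ⟨B₁, hB₁⟩ := hcoord z₁ hz₁
  obtain ⟨B₂, hB₂⟩ := hcoord z₂ hz₂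
  -- the combination map of `z_k` is `a ↦ φ (a ᵥ* B_k)`; it is injective, hence surjective, so `B_k` is a unit
  have hkey : ∀ (z : J → P) (B : Matrix J J (ZMod M)), (∀ i, φ (Multiplicative.ofAdd (B i)) = z i) →
      ∀ c : J → ZMod M, ∏ i, z i ^ (c i).val = φ (Multiplicative.ofAdd (c ᵥ* B)) := fun z B hB c => by
    rw [← prod_map_ofAdd_pow_val_eq_map_vecMul]
    exact Finset.prod_congr rfl fun i _ => by rw [hB]
  have hunit : ∀ (z : J → P) (B : Matrix J J (ZMod M)), (∀ i, φ (Multiplicative.ofAdd (B i)) = z i) →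
      (Function.Injective fun a : J → ZMod M => ∏ i, z i ^ (a i).val) → IsUnit B := by
    intro z B hB hinj
    rw [← Matrix.vecMul_surjective_iff_isUnit]
    refine Finite.surjective_of_injective fun a a' haa' => hinj ?_
    change ∏ i, z i ^ (a i).val = ∏ i, z i ^ (a' i).val
    rw [hkey z B hB, hkey z B hB]
    exact congrArg _ (congrArg _ haa')
  obtain ⟨u₁, hu₁⟩ := hunit z₁ B₁ hB₁ h₁
  obtain ⟨u₂, hu₂⟩ := hunit z₂ B₂ hB₂ h₂
  refine ⟨u₂ * u₁⁻¹, fun i => ?_⟩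
  -- `∏ⱼ z₁(j)^{γ₀ᵢⱼ} = φ(γ₀ᵢ ᵥ* B₁) = φ((γ₀ B₁)ᵢ) = φ(B₂ i) = z₂ i`
  have hmat : ((u₂ * u₁⁻¹ : Matrix.GeneralLinearGroup J (ZMod M)) : Matrix J J (ZMod M)) * B₁ = B₂ := by
    rw [← hu₁, ← Units.val_mul, inv_mul_cancel_right, hu₂]
  have hrow : ((u₂ * u₁⁻¹ : Matrix.GeneralLinearGroup J (ZMod M)) : Matrix J J (ZMod M)) i ᵥ* B₁ = B₂ i := by
    rw [← hmat]
    rfl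
  rw [hkey z₁ B₁ hB₁, hrow, hB₂]

/-! ### §2 The action on the fibre power `T = A[M]^J` -/

variable {S : Scheme.{u}} (A : AbelianSchemeOver S) [IsCommMonObj A.X] {J : Type} [Fintype J] [DecidableEq J]
  {M : ℕ} [NeZero M]
  (AM : Over S) (incl : AM ⟶ A.X) (hpow : ∀ (Y : Over S) (w : Y ⟶ AM), (w ≫ incl) ^ M = 1)
  (hlift : ∀ (Y : Over S) (z : Y ⟶ A.X), z ^ M = 1 → ∃ w : Y ⟶ AM, w ≫ incl = z)
  (hinj : ∀ (Y : Over S) (w w' : Y ⟶ AM), w ≫ incl = w' ≫ incl → w = w')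
  (T : Over S) (π : J → (T ⟶ AM))
  (hTex : ∀ (T' : Over S) (x : J → (T' ⟶ AM)), ∃ v : T' ⟶ T, ∀ i, v ≫ π i = x i)
  (hTuniq : ∀ (T' : Over S) (v v' : T' ⟶ T), (∀ i, v ≫ π i = v' ≫ π i) → v = v')

omit [DecidableEq J] [NeZero M] in
/-- **Precomposition distributes over the combinations**: for `v : Y → T` over `S`,
`v ≫ ∏ᵢ (πᵢ ≫ incl)^{nᵢ} = ∏ᵢ (v ≫ πᵢ ≫ incl)^{nᵢ}` (`f ↦ v ≫ f` is a monoid homomorphism, Mathlib `MonObj.comp_mul`).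
[cite: MumfordFogartyKirwan1994, Ch. 7 §2 Definition 7.1 (p. 129)] -/
theorem comp_prod_pow {Y Z : Over S} (v : Y ⟶ Z) (f : J → (Z ⟶ A.X)) (n : J → ℕ) :
    v ≫ ∏ i, f i ^ n i = ∏ i, (v ≫ f i) ^ n i := by
  let φ : (Z ⟶ A.X) →* (Y ⟶ A.X) := MonoidHom.mk' (fun f => v ≫ f) (MonObj.comp_mul v)
  change φ (∏ i, f i ^ n i) = ∏ i, φ (f i) ^ n i
  rw [map_prod]
  exact Finset.prod_congr rfl fun i _ => map_pow φ _ _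

omit [DecidableEq J] [NeZero M] in
include hpow in
/-- The re-based tautological points `∏ⱼ (πⱼ ≫ incl)^{γ₀ᵢⱼ}` are `M`-torsion. [cite: MumfordFogartyKirwan1994, Ch. 7 §2 Proposition 7.3, proof, step (IV) (pp. 133–134)] -/
theorem prod_pow_val_pow_eq_one {Y : Over S} (x : J → (Y ⟶ AM)) (n : J → ZMod M) :
    (∏ j, (x j ≫ incl) ^ (n j).val) ^ M = 1 := by
  rw [← Finset.prod_pow]
  exact Finset.prod_eq_one fun j _ => by rw [← pow_mul, mul_comm, pow_mul, hpow, one_pow]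

omit [DecidableEq J] in
include hpow in
/-- **The transport formula**: if `u : T → T` re-bases by `γ₀` (`u ≫ πᵢ ≫ incl = ∏ⱼ (πⱼ ≫ incl)^{γ₀ᵢⱼ}`), then for every coefficient
vector `a`, `u ≫ ∏ᵢ (πᵢ ≫ incl)^{aᵢ} = ∏ⱼ (πⱼ ≫ incl)^{(a ᵥ* γ₀)ⱼ}` — pulling back `Σ aᵢτᵢ` along the re-basing gives `Σ (aγ₀)ⱼ τⱼ`.
[cite: MumfordFogartyKirwan1994, Ch. 7 §2 Proposition 7.3, proof, step (IV) (pp. 133–134)] -/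
theorem comp_prod_pow_val_of_rebase {u : T ⟶ T} {γ₀ : Matrix J J (ZMod M)}
    (hu : ∀ i, u ≫ π i ≫ incl = ∏ j, (π j ≫ incl) ^ (γ₀ i j).val) (a : J → ZMod M) :
    u ≫ ∏ i, (π i ≫ incl) ^ (a i).val = ∏ j, (π j ≫ incl) ^ ((a ᵥ* γ₀) j).val := by
  rw [A.comp_prod_pow]
  simp only [hu]
  exact prod_pow_val_pow_val_eq _ (fun k => hpow T (π k)) γ₀ a

include hpow hlift hinj hTex hTuniq in
/-- **THE RE-BASING ACTION of `GL(J, ℤ/M)` on the fibre power `T = A[M]^J`** ([MumfordFogartyKirwan1994] Prop. 7.3 step (IV) /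
Lemma 7.11: `GL(2g, ℤ/n)` acts on tuples of `n`-torsion points by `(τᵢ) ↦ (Σⱼ γ₀ᵢⱼ τⱼ)`): there is an action `ρ` of
`GL(J, ℤ/M)` on `T` over `S` (★ `RelativeSpec.ActionOver T.hom`) such that each `ρ.aut γ₀` underlies an `S`-morphism `u_γ₀ : T → T`
characterised by `u_γ₀ ≫ πᵢ ≫ incl = ∏ⱼ (πⱼ ≫ incl)^{γ₀ᵢⱼ}` (rows; so `u_{γ₀′} ≫ u_γ₀ = u_{γ₀γ₀′}`, Mathlib's `Aut` multiplication).
Construction: the re-based tautological points are `M`-torsion, so they factor through `A_M` (`hlift`), giving `u_γ₀` by the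
universal property of the fibre power (`hTex`); `u_1 = 1` and `u_{γ₀′} ≫ u_γ₀ = u_{γ₀γ₀′}` by uniqueness (`hTuniq`, `hinj`) and the
exponent arithmetic of §1. [cite: MumfordFogartyKirwan1994, Ch. 7 §2 Proposition 7.3, proof, step (IV) (pp. 133–134)]
[cite: MumfordFogartyKirwan1994, Ch. 7 §3 Lemma 7.11 (p. 140)] [cite: GortzWedhorn2023, Prop. 27.188 (1) (p. 675)] -/
theorem exists_actionOver_rebase :
    ∃ ρ : ActionOver T.hom (Matrix.GeneralLinearGroup J (ZMod M)),
      ∀ γ₀ : Matrix.GeneralLinearGroup J (ZMod M), ∃ uγ₀ : T ⟶ T, uγ₀.left = (ρ.aut γ₀).hom ∧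
        ∀ i, uγ₀ ≫ π i ≫ incl = ∏ j, (π j ≫ incl) ^ ((γ₀ : Matrix J J (ZMod M)) i j).val := by
  classical
  -- the re-based tautological points lift to `A_M`, and define `u γ₀ : T → T`
  choose w hw using fun (γ₀ : Matrix.GeneralLinearGroup J (ZMod M)) (i : J) =>
    hlift T _ (A.prod_pow_val_pow_eq_one AM incl hpow π ((γ₀ : Matrix J J (ZMod M)) i))
  choose u hu using fun γ₀ : Matrix.GeneralLinearGroup J (ZMod M) => hTex T (w γ₀)
  have huc : ∀ γ₀ i, u γ₀ ≫ π i ≫ incl = ∏ j, (π j ≫ incl) ^ ((γ₀ : Matrix J J (ZMod M)) i j).val :=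
    fun γ₀ i => by rw [← Category.assoc, hu, hw]
  -- `u 1 = 𝟙`
  have hone : u 1 = 𝟙 T := by
    refine hTuniq T _ _ fun i => hinj T _ _ ?_
    rw [Category.assoc, huc, Category.id_comp, Units.val_one]
    exact prod_pow_val_one_row _ (fun k => hpow T (π k)) i
  -- `u γ₀' ≫ u γ₀ = u (γ₀ * γ₀')`
  have hmul : ∀ γ₀ γ₀', u γ₀' ≫ u γ₀ = u (γ₀ * γ₀') := fun γ₀ γ₀' => by
    refine hTuniq T _ _ fun i => hinj T _ _ ?_
    simp only [Category.assoc]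
    rw [huc γ₀ i, huc (γ₀ * γ₀') i, A.comp_prod_pow_val_of_rebase AM incl hpow T π (huc γ₀'), Units.val_mul]
    rfl
  -- the automorphisms
  have hinv₁ : ∀ γ₀, (u γ₀).left ≫ (u γ₀⁻¹).left = 𝟙 _ := fun γ₀ => by
    rw [← Over.comp_left, hmul, inv_mul_cancel, hone, Over.id_left]
  have hinv₂ : ∀ γ₀, (u γ₀⁻¹).left ≫ (u γ₀).left = 𝟙 _ := fun γ₀ => by
    rw [← Over.comp_left, hmul, mul_inv_cancel, hone, Over.id_left]
  refine ⟨⟨⟨⟨fun γ₀ => ⟨(u γ₀).left, (u γ₀⁻¹).left, hinv₁ γ₀, hinv₂ γ₀⟩, ?_⟩, fun γ₀ γ₀' => ?_⟩, fun γ₀ => Over.w (u γ₀)⟩,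
    fun γ₀ => ⟨u γ₀, rfl, huc γ₀⟩⟩
  · ext
    change (u 1).left = 𝟙 _
    rw [hone, Over.id_left]
  · ext
    change (u (γ₀ * γ₀')).left = (u γ₀').left ≫ (u γ₀).left
    rw [← Over.comp_left, hmul]

end AbelianSchemeOver

end Literature.AlgebraicGeometry.AbelianSchemes

end
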